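import Mathlib
import HarnessLib
import Literature.Topology.FourManifolds.DehnSurgery
import Literature.Topology.FourManifolds.LeeRasmussen
import Literature.Topology.FourManifolds.Rasmussen
import Literature.Topology.FourManifolds.SliceRibbon
import Literature.Topology.FourManifolds.SliceGenus
import Literature.Topology.FourManifolds.HomotopyBallSlice
import Literature.Topology.FourManifolds.ZeroSurgeryHomotopyBallSlice
import Literature.Topology.FourManifolds.ZeroSurgeryHomotopyBallSliceProofs
import Literature.Topology.FourManifolds.ZeroSurgeryHomotopyBallSliceHolds
import Literature.Barriers.SmoothPoincare4.GluckTwistsDissolve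

/-!
# Sketch — crux-ideate stmt-SmoothPoincare4-0366 (ZseCruxRasmussen), ideator 1, round 1

First lemmas of the three idea cards, typed over existing declarations.
* Card A `forced-profile-inversion`: `fgmw_of_crux` (PROVED here), `not_crux_of_question911`
  (PROVED), `WitnessProfile` (statement).
* Card B `knotted-red-window`: `ThreeValued` (statement; follows from the Rasmussen facts
  `HasRasmussenInvariant.add/mirror/reverse` + `abs_le_two_mul_sliceGenus`), `crux_of_ribbon_witness` (PROVED).
* Card C `monodromy-kernel-engine`: posited interface `MonodromyModel` + `FibredFriendsClassification`,
  `KernelWitness`, `crux_of_kernelWitness` (PROVED modulo the interface axioms as hypotheses).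
-/

noncomputable section

namespace Summit.SmoothPoincare4.SmoothPoincare4.Cruxes.ZseCruxRasmussen.Ideator1

open scoped Manifold ContDiff Topology
open Literature.Topology.FourManifolds

/-- The crux, verbatim from the ledger signature of stmt-SmoothPoincare4-0366. -/
def Crux : Prop :=
  ∃ (K K' : Literature.Topology.FourManifolds.Knot) (Y : Type) (_ : TopologicalSpace Y)
    (_ : ChartedSpace (EuclideanSpace ℝ (Fin 3)) Y) (s : ℤ),
    Literature.Topology.FourManifolds.IsIntegralSurgery (𝓡 3) Y K 0 ∧
    Literature.Topology.FourManifolds.IsIntegralSurgery (𝓡 3) Y K' 0 ∧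
    K.IsSmoothlySlice ∧ K'.HasRasmussenInvariant s ∧ s ≠ 0

/-! ## Card A — forced-profile inversion -/

/-- A1 (proved): every witness of the crux is, with the SAME `K'`, a witness of the FGMW
`s`-strategy (`K'` slice in a homotopy 4-ball with `s(K') ≠ 0`), by Manolescu–Piccirillo's
Lemma 3.3 (`W = S⁴`), which is a theorem of the tree. -/
theorem fgmw_of_crux (h : Crux) : Literature.Barriers.SmoothPoincare4.FGMWRasmussenStrategy := by
  obtain ⟨K, K', Y, _, _, s, hK, hK', hsl, hs, hs0⟩ := h
  refine ⟨K', ?_, s, hs, hs0⟩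
  exact Knot.ManolescuPiccirillo2023_lemma33_sphere_holds K K' Y
    ((FramedLink.isSurgery_single_iff K 0).mpr hK) ((FramedLink.isSurgery_single_iff K' 0).mpr hK') hsl

/-- A1' (proved): the kill direction made formal — a positive answer to MMSW Question 9.11
(knot case) refutes the crux. -/
theorem not_crux_of_question911 (hQ : Literature.Barriers.SmoothPoincare4.MMSW2023Question911Knot) :
    ¬ Crux := fun h =>
  (Literature.Barriers.SmoothPoincare4.not_fgmwRasmussenStrategy_iff_question.mpr hQ) (fgmw_of_crux h)

/-- Freedman (a homotopy 4-ball is homeomorphic to `B⁴`): slice in a homotopy ball ⇒ topologically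
slice. Not in the tree; stated as a Prop (Dunfield–Gong 2025, proof of Thm 5.14; Freedman–Quinn §11). -/
def isTopologicallySlice_of_isHomotopyBallSlice : Prop :=
  ∀ K : Literature.Topology.FourManifolds.Knot, K.IsHomotopyBallSlice → K.IsTopologicallySlice

/-- A2 `WitnessProfile` (statement): in any witness `(K, K', Y, s)` the non-slice partner `K'` is slice in
a homotopy ball, topologically slice, not smoothly slice, and has the Seifert genus of `K` (Gabai Cor. 8.3).
The knot-Floer clauses of the profile (`τ = ν = ε = 0`, `Υ ≡ 0`) are informal: no knot Floer homology in the tree. -/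
def WitnessProfile : Prop :=
  ∀ (K K' : Literature.Topology.FourManifolds.Knot) (Y : Type) [TopologicalSpace Y]
    [ChartedSpace (EuclideanSpace ℝ (Fin 3)) Y] (s : ℤ),
    Literature.Topology.FourManifolds.IsIntegralSurgery (𝓡 3) Y K 0 →
    Literature.Topology.FourManifolds.IsIntegralSurgery (𝓡 3) Y K' 0 →
    K.IsSmoothlySlice → K'.HasRasmussenInvariant s → s ≠ 0 →
      K'.IsHomotopyBallSlice ∧ K'.IsTopologicallySlice ∧ ¬ K'.IsSmoothlySlice ∧ K'.genus = K.genus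

/-- The first two clauses of the profile, proved from A1's ingredients, Rasmussen's theorem (named
fact) and Freedman (Prop above). -/
theorem witnessProfile_core (hR : Literature.Topology.FourManifolds.eq_zero_of_isSmoothlySlice)
    (hF : isTopologicallySlice_of_isHomotopyBallSlice)
    (K K' : Literature.Topology.FourManifolds.Knot) (Y : Type) [TopologicalSpace Y]
    [ChartedSpace (EuclideanSpace ℝ (Fin 3)) Y] (s : ℤ)
    (hK : Literature.Topology.FourManifolds.IsIntegralSurgery (𝓡 3) Y K 0)
    (hK' : Literature.Topology.FourManifolds.IsIntegralSurgery (𝓡 3) Y K' 0)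
    (hsl : K.IsSmoothlySlice) (hs : K'.HasRasmussenInvariant s) (hs0 : s ≠ 0) :
    K'.IsHomotopyBallSlice ∧ K'.IsTopologicallySlice ∧ ¬ K'.IsSmoothlySlice := by
  have hH : K'.IsHomotopyBallSlice :=
    Knot.ManolescuPiccirillo2023_lemma33_sphere_holds K K' Y
      ((FramedLink.isSurgery_single_iff K 0).mpr hK) ((FramedLink.isSurgery_single_iff K' 0).mpr hK') hsl
  exact ⟨hH, hF K' hH, fun hsl' => hs0 (hR hs hsl')⟩

/-! ## Card B — knotted-red window over a ribbon-strip base -/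

/-- B1 `ThreeValued` (statement): if `K # r(K'̄)` has smooth slice genus `≤ 1` (e.g. `K` and `K'`
differ by knotting one band = two saddles), then `|s(K) − s(K')| ≤ 2`. Consequence of Rasmussen's
additivity, mirror, reversal and the slice-genus bound (all named facts in `Rasmussen.lean`). -/
def ThreeValued : Prop :=
  ∀ {K K' D : Literature.Topology.FourManifolds.Knot} {s s' : ℤ},
    K.HasRasmussenInvariant s → K'.HasRasmussenInvariant s' →
    Knot.IsConnectedSum K (K'.mirror).reverse D → D.sliceGenus ≤ 1 → |s - s'| ≤ 2

/-- B1 reduced to the four Rasmussen facts (proved). -/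
theorem threeValued_of_facts [SphereEmbedding.SmoothnessFacts]
    (hadd : Literature.Topology.FourManifolds.HasRasmussenInvariant.add)
    (hmir : Literature.Topology.FourManifolds.HasRasmussenInvariant.mirror)
    (hrev : Literature.Topology.FourManifolds.HasRasmussenInvariant.reverse)
    (hsg : Literature.Topology.FourManifolds.abs_le_two_mul_sliceGenus) : ThreeValued := by
  intro K K' D s s' hs hs' hD hg
  have hm : (K'.mirror).HasRasmussenInvariant (-s') := hmir hs'
  have hr : ((K'.mirror).reverse).HasRasmussenInvariant (-s') := hrev hm
  have hDs : D.HasRasmussenInvariant (s + -s') := hadd hs hr hD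
  have hb := hsg hDs
  have : (D.sliceGenus : ℤ) ≤ 1 := by exact_mod_cast hg
  have h2 : |s + -s'| ≤ 2 := by linarith
  simpa [sub_eq_add_neg] using h2

/-- B2 (proved): the supply shape — a RIBBON `K` and a `0`-friend `K'` with `s ≠ 0` give the crux. -/
theorem crux_of_ribbon_witness
    (h : ∃ (K K' : Literature.Topology.FourManifolds.Knot) (Y : Type) (_ : TopologicalSpace Y)
      (_ : ChartedSpace (EuclideanSpace ℝ (Fin 3)) Y) (s : ℤ),
      Literature.Topology.FourManifolds.IsIntegralSurgery (𝓡 3) Y K 0 ∧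
      Literature.Topology.FourManifolds.IsIntegralSurgery (𝓡 3) Y K' 0 ∧
      K.IsRibbon ∧ K'.HasRasmussenInvariant s ∧ s ≠ 0) : Crux := by
  obtain ⟨K, K', Y, _, _, s, hK, hK', hr, hs, hs0⟩ := h
  exact ⟨K, K', Y, _, _, s, hK, hK', hr.isSmoothlySlice, hs, hs0⟩

/-! ## Card C — monodromy-kernel engine (posited interface) -/

/-- Posited interface: monodromy data of fibred knots of a fixed genus `g ≥ 2`.
`MCGb` models `Mod(Σ_g^1)` (boundary fixed), `MCG` models `Mod(Σ_g)`, `cap` the capping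
homomorphism (kernel ≅ π₁ of the unit tangent bundle: point-pushes and the boundary twist),
`IsMonodromyOf K h` says `K` is fibred with fibre `Σ_g^1` and monodromy `h`, `RealisesSphere h`
says the open book `(Σ_g^1, h)` has total space `S³` (then its binding is a fibred knot). A
CONSTRUCTION item (an instance from Nielsen–Thurston / open books) is separate; nothing about
existence is smuggled in here. -/
structure MonodromyModel where
  MCGb : Type
  MCG : Type
  instb : Group MCGb
  inst : Group MCG
  cap : MCGb →* MCG
  IsMonodromyOf : Literature.Topology.FourManifolds.Knot → MCGb → Prop
  RealisesSphere : MCGb → Prop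
  binding : ∀ h : MCGb, RealisesSphere h → Literature.Topology.FourManifolds.Knot
  binding_isMonodromyOf : ∀ (h : MCGb) (hh : RealisesSphere h), IsMonodromyOf (binding h hh) h

attribute [instance] MonodromyModel.instb MonodromyModel.inst

/-- C1 `FibredFriendsClassification` (statement over the interface): two fibred knots have a common
`0`-surgery iff their capped monodromies are conjugate (Gabai 1987: `0`-surgery of a fibred knot is the
mapping torus of the capped monodromy and fibredness/genus are `0`-surgery invariants; Thurston-norm
uniqueness of the fibration of a `b₁ = 1` mapping torus; Abe–Tagami 2016 §5.5). -/
def FibredFriendsClassification (M : MonodromyModel) : Prop :=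
  ∀ (K K' : Literature.Topology.FourManifolds.Knot) (h h' : M.MCGb),
    M.IsMonodromyOf K h → M.IsMonodromyOf K' h' →
    ((∃ (Y : Type) (_ : TopologicalSpace Y) (_ : ChartedSpace (EuclideanSpace ℝ (Fin 3)) Y),
        Literature.Topology.FourManifolds.IsIntegralSurgery (𝓡 3) Y K 0 ∧
        Literature.Topology.FourManifolds.IsIntegralSurgery (𝓡 3) Y K' 0) ↔
      IsConj (M.cap h) (M.cap h'))

/-- C2 `KernelWitness`: the engine's target — a RIBBON fibred seed `K` with monodromy `h`, an element
`z` of the capping kernel such that `(Σ, h z)` is still an open book of `S³`, whose binding has `s ≠ 0`. -/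
def KernelWitness (M : MonodromyModel) : Prop :=
  ∃ (K : Literature.Topology.FourManifolds.Knot) (h z : M.MCGb) (hz : M.RealisesSphere (h * z)) (s : ℤ),
    K.IsRibbon ∧ M.IsMonodromyOf K h ∧ M.cap z = 1 ∧
    (M.binding (h * z) hz).HasRasmussenInvariant s ∧ s ≠ 0

/-- C3 (proved modulo C1): a kernel witness is a crux witness. -/
theorem crux_of_kernelWitness (M : MonodromyModel) (hC : FibredFriendsClassification M)
    (hW : KernelWitness M) : Crux := by
  obtain ⟨K, h, z, hz, s, hr, hK, hz1, hs, hs0⟩ := hW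
  have hconj : IsConj (M.cap h) (M.cap (h * z)) := by
    rw [map_mul, hz1, mul_one]
  obtain ⟨Y, _, _, hY, hY'⟩ := (hC K (M.binding (h * z) hz) h (h * z) hK
    (M.binding_isMonodromyOf (h * z) hz)).mpr hconj
  exact ⟨K, M.binding (h * z) hz, Y, _, _, s, hY, hY', hr.isSmoothlySlice, hs, hs0⟩

end Summit.SmoothPoincare4.SmoothPoincare4.Cruxes.ZseCruxRasmussen.Ideator1

end
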